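import Summits.ValiantsHypothesis.ValiantsHypothesis.Theorems.KPlusLogSqLawTropicalBAffineSkeleton

/-!
# Route «KPlusLogSqLaw», crux `TropicalB` (stmt-ValiantsHypothesis-19771) — THE BALANCED-SKELETON LAW:
# a static chain whose permutations come from a family with uniform cell coverage `r` and pair coverage `λ`
# has `t²·(n+1) ≤ m²r + m³(mλ − r) + t²(2t+1)^(K−1)` for every `t`

HONEST FRAMING.  Helper toward the registered stubs `stub_tropThin` / `stub_tropFat` of `Cruxes/TropicalB/Lines/birth.lean`
(crux `Summit.ValiantsHypothesis.ValiantsHypothesis.Theses.KPlusLogSqLaw.TropicalB`, item stmt-ValiantsHypothesis-19771, route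
KPlusLogSqLaw; cell `pub-symmetroid`, seat val-sym-trop-p4 g9, 2026-08-27; `--supports … --as helper`).  A NO-GO ROW OF THE REGISTER
CENSUS (architecture sector), the abstract form of the affine-skeleton law (`…TropicalBAffineSkeleton`): nothing here bounds
`TropicalB` for general designs, and nothing bears on `WeakLifting`, DoorA26 / DoorA34, `MatrixDescartes` (stmt-ValiantsHypothesis-18050)
or VP ≠ VNP.

SETTING.  A SKELETON is a finite family `F` of permutations of `Fin m`; it is BALANCED with parameters `(r, λ)` when every cell
`(a, b)` is covered by exactly `r` members (`π b = a`) and two cells in general position (different rows AND columns) are covered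
together by at most `λ` members (affine group of `ZMod p`: `r = p − 1`, `λ = 1`; sharply 2-transitive sets; 2-transitive groups:
`λ = r/(m−1)`; `S_m`: `r = (m−1)!`, `λ = (m−2)!`).
THE LAW (`balancedSkeleton_law`).  For a STATIC design of format `(m, K)` and a chain `q₀, …, qₙ` of terms dominant at strictly
increasing integer slopes, consecutive terms distinct, all permutations in a balanced skeleton `F`:

  `t² · (n + 1) ≤ m²·r + m³·(m·λ − r) + t² · (2t + 1)^(K − 1)`   for every `t : ℕ` (truncated subtraction).

READING.  For 2-design-like skeletons (`mλ ≈ r`; 2-transitive groups give `m²r + m³(mλ − r) ≤ 3m²r = 3m|F|`) this is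
`n + 1 = O((m·|F|)^{(K−1)/(K+1)})`: `≈ √(m·|F|)` states at `K = 3` (the GEOMETRIC MEAN of size and number of permutations),
`(m|F|)^{3/5}` at `K = 4`.  A balanced skeleton needs `|F| ≳ m³` members for the quadratic static `K = 3` capacity that the
UNBALANCED «one Hamiltonian rotation + local ports» skeleton of SHIFT-THREE gets from `≈ m²/9` members, and `|F| ≳ m⁴` for a
cubic `K = 4` family: registers live on unbalanced pair coverage.  PROOF: second moment (`Σ_F h = r|S|`, `Σ_F h² ≤ r|S| + λ|S|²`,
`|F| = rm` ⇒ `Σ_F (m·h − |S|)² ≤ m|S|(mr + |S|(mλ − r))`), class histograms of a STATIC chain = coverage counts of the class cell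
sets, pairwise distinct by `TropicalCensus.slope_lt_of_dominant`, then the packing lemma `AffinePlane.packing`.
[folklore: second-moment method; this cell: the register-census reading]
-/

set_option linter.dupNamespace false
set_option autoImplicit false

namespace Summit.ValiantsHypothesis.ValiantsHypothesis.Theorems.KPlusLogSqLaw

namespace BalancedSkeleton

open Summit.ValiantsHypothesis.ValiantsHypothesis.Theorems.MatrixDescartes.Negative
open Summit.ValiantsHypothesis.ValiantsHypothesis.Theorems.LacunarySymmetroidMatrixDescartes
open Summit.ValiantsHypothesis.ValiantsHypothesis.Theorems.LacunarySymmetroidMatrixDescartes.TropicalCensus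
open Finset

variable {m K : ℕ}

/-! ## 1. Coverage sums over a skeleton -/

/-- the coverage count of a cell set by a permutation, as a sum of indicators. [folklore] -/
theorem cover_eq_sum (π : Equiv.Perm (Fin m)) (S : Finset (Fin m × Fin m)) :
    ((univ.filter fun b : Fin m => (π b, b) ∈ S).card : ℤ) = ∑ x ∈ S, if π x.2 = x.1 then (1 : ℤ) else 0 := by
  rw [Finset.sum_ite, Finset.sum_const_zero, add_zero, Finset.sum_const, nsmul_eq_mul, mul_one]
  congr 1
  refine Finset.card_bij' (fun b _ => (π b, b)) (fun x _ => x.2) ?_ ?_ (fun b _ => rfl) ?_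
  · intro b hb
    rw [Finset.mem_filter] at hb ⊢
    exact ⟨hb.2, rfl⟩
  · intro x hx
    rw [Finset.mem_filter] at hx ⊢
    have : (π x.2, x.2) = x := Prod.ext hx.2 rfl
    exact ⟨mem_univ _, by rw [this]; exact hx.1⟩
  · intro x hx
    rw [Finset.mem_filter] at hx
    exact Prod.ext hx.2 rfl

/-- **first moment**: under uniform cell coverage `r`, `Σ_{π∈F} h_π(S) = r·|S|`. [folklore] -/
theorem sum_cover (F : Finset (Equiv.Perm (Fin m))) (r : ℕ)
    (hr : ∀ a b : Fin m, (F.filter fun π => π b = a).card = r) (S : Finset (Fin m × Fin m)) :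
    ∑ π ∈ F, ((univ.filter fun b : Fin m => (π b, b) ∈ S).card : ℤ) = r * S.card := by
  simp_rw [cover_eq_sum]
  rw [Finset.sum_comm]
  have : ∀ x ∈ S, (∑ π ∈ F, if π x.2 = x.1 then (1 : ℤ) else 0) = r := by
    intro x _
    rw [← Finset.sum_filter, Finset.sum_const, nsmul_eq_mul, mul_one, hr x.1 x.2]
  rw [Finset.sum_congr rfl this, Finset.sum_const, nsmul_eq_mul]
  ring

/-- two distinct cells covered by one permutation are in general position. [folklore] -/
theorem general_of_cover {π : Equiv.Perm (Fin m)} {x y : Fin m × Fin m} (hxy : x ≠ y) (hx : π x.2 = x.1) (hy : π y.2 = y.1) :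
    x.1 ≠ y.1 ∧ x.2 ≠ y.2 := by
  refine ⟨fun h => hxy (Prod.ext h (π.injective (by rw [hx, hy, h]))), fun h => hxy (Prod.ext (by rw [← hx, ← hy, h]) h)⟩

/-- **second moment**: under uniform cell coverage `r` and pair coverage `≤ λ`, `Σ_{π∈F} h_π(S)² ≤ r·|S| + λ·|S|²`. [folklore] -/
theorem sum_cover_sq_le (F : Finset (Equiv.Perm (Fin m))) (r lam : ℕ)
    (hr : ∀ a b : Fin m, (F.filter fun π => π b = a).card = r)
    (hlam : ∀ a b a' b' : Fin m, a ≠ a' → b ≠ b' → (F.filter fun π => π b = a ∧ π b' = a').card ≤ lam)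
    (S : Finset (Fin m × Fin m)) :
    ∑ π ∈ F, ((univ.filter fun b : Fin m => (π b, b) ∈ S).card : ℤ) ^ 2 ≤ r * S.card + lam * (S.card : ℤ) ^ 2 := by
  have hsq : ∀ π : Equiv.Perm (Fin m), ((univ.filter fun b : Fin m => (π b, b) ∈ S).card : ℤ) ^ 2 =
      ∑ x ∈ S, ∑ y ∈ S, if π x.2 = x.1 ∧ π y.2 = y.1 then (1 : ℤ) else 0 := by
    intro π
    rw [sq, cover_eq_sum, Finset.sum_mul]
    refine Finset.sum_congr rfl fun x _ => ?_
    rw [Finset.mul_sum]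
    refine Finset.sum_congr rfl fun y _ => ?_
    by_cases hx : π x.2 = x.1 <;> by_cases hy : π y.2 = y.1 <;> simp [hx, hy]
  simp_rw [hsq]
  rw [Finset.sum_comm]
  -- per `x`, the inner double sum is `≤ r + λ(|S| - 1) ≤ r + λ|S|`
  have inner : ∀ x ∈ S, (∑ π ∈ F, ∑ y ∈ S, if π x.2 = x.1 ∧ π y.2 = y.1 then (1 : ℤ) else 0) ≤ r + lam * S.card := by
    intro x _
    rw [Finset.sum_comm]
    have hy : ∀ y ∈ S, (∑ π ∈ F, if π x.2 = x.1 ∧ π y.2 = y.1 then (1 : ℤ) else 0) ≤ if y = x then (r : ℤ) else lam := by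
      intro y _
      rw [← Finset.sum_filter, Finset.sum_const, nsmul_eq_mul, mul_one]
      split_ifs with hyx
      · subst hyx
        have : (F.filter fun π => π y.2 = y.1 ∧ π y.2 = y.1) = F.filter fun π => π y.2 = y.1 := by
          ext π; simp
        rw [this, hr y.1 y.2]
      · -- distinct cells: either never covered together, or in general position and covered `≤ λ` times
        by_cases hgen : x.1 ≠ y.1 ∧ x.2 ≠ y.2
        · exact_mod_cast hlam x.1 x.2 y.1 y.2 hgen.1 hgen.2
        · have : (F.filter fun π => π x.2 = x.1 ∧ π y.2 = y.1) = ∅ := by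
            rw [Finset.filter_eq_empty_iff]
            intro π _ h
            exact hgen (general_of_cover (Ne.symm hyx) h.1 h.2)
          rw [this, Finset.card_empty]
          exact_mod_cast Nat.zero_le lam
    refine (Finset.sum_le_sum hy).trans ?_
    rw [Finset.sum_ite, Finset.sum_const, Finset.sum_const, nsmul_eq_mul, nsmul_eq_mul]
    have h1 : ((S.filter fun y => y = x).card : ℤ) ≤ 1 := by
      have : (S.filter fun y => y = x) ⊆ {x} := fun y hy => by
        rw [Finset.mem_singleton]; exact (Finset.mem_filter.mp hy).2
      exact_mod_cast (Finset.card_le_card this).trans (Finset.card_singleton x).le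
    have h2 : ((S.filter fun y => ¬ y = x).card : ℤ) ≤ S.card := by exact_mod_cast Finset.card_filter_le _ _
    have hr0 : (0 : ℤ) ≤ r := by positivity
    have hl0 : (0 : ℤ) ≤ lam := by positivity
    nlinarith
  refine (Finset.sum_le_sum inner).trans ?_
  rw [Finset.sum_const, nsmul_eq_mul]
  ring_nf
  rfl

/-- the size of a skeleton with uniform cell coverage `r` is `r·m` (count incidences through one column). [folklore] -/
theorem card_skeleton (F : Finset (Equiv.Perm (Fin m))) (r : ℕ)
    (hr : ∀ a b : Fin m, (F.filter fun π => π b = a).card = r) (hm : 0 < m) : F.card = r * m := by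
  have h := Finset.card_eq_sum_card_fiberwise (s := F) (t := (univ : Finset (Fin m)))
    (f := fun π => π ⟨0, hm⟩) (fun π _ => mem_univ _)
  rw [h]
  have : ∀ a ∈ (univ : Finset (Fin m)), (F.filter fun π => π ⟨0, hm⟩ = a).card = r := fun a _ => hr a ⟨0, hm⟩
  rw [Finset.sum_congr rfl this, Finset.sum_const, card_univ, Fintype.card_fin, smul_eq_mul, mul_comm]

/-- **VARIANCE BOUND** of coverage counts over a balanced skeleton:
`Σ_{π∈F} (m·h_π(S) − |S|)² ≤ m·|S|·(m·r + |S|·(m·λ − r))`. [folklore] -/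
theorem cover_variance_le (F : Finset (Equiv.Perm (Fin m))) (r lam : ℕ)
    (hr : ∀ a b : Fin m, (F.filter fun π => π b = a).card = r)
    (hlam : ∀ a b a' b' : Fin m, a ≠ a' → b ≠ b' → (F.filter fun π => π b = a ∧ π b' = a').card ≤ lam)
    (S : Finset (Fin m × Fin m)) :
    ∑ π ∈ F, ((m : ℤ) * (univ.filter fun b : Fin m => (π b, b) ∈ S).card - S.card) ^ 2 ≤
      (m : ℤ) * S.card * (m * r + S.card * (m * lam - r)) := by
  rcases Nat.eq_zero_or_pos m with hm | hm
  · subst hm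
    have hS : S = ∅ := by
      rw [Finset.eq_empty_iff_forall_notMem]
      intro x; exact x.1.elim0
    subst hS
    simp
  have expand : ∀ π : Equiv.Perm (Fin m), ((m : ℤ) * (univ.filter fun b : Fin m => (π b, b) ∈ S).card - S.card) ^ 2 =
      (m : ℤ) ^ 2 * ((univ.filter fun b : Fin m => (π b, b) ∈ S).card : ℤ) ^ 2
        - 2 * m * S.card * ((univ.filter fun b : Fin m => (π b, b) ∈ S).card : ℤ) + (S.card : ℤ) ^ 2 := fun π => by ring
  simp_rw [expand]
  rw [Finset.sum_add_distrib, Finset.sum_sub_distrib, ← Finset.mul_sum, ← Finset.mul_sum, sum_cover F r hr S,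
    Finset.sum_const, nsmul_eq_mul, card_skeleton F r hr hm]
  have h2 := sum_cover_sq_le F r lam hr hlam S
  have hm0 : (0 : ℤ) ≤ (m : ℤ) ^ 2 := by positivity
  push_cast
  nlinarith [mul_le_mul_of_nonneg_left h2 hm0]

/-! ## 2. Static designs: class histograms are coverage counts -/

/-- for a present term of a STATIC design, the number of class-`l` columns is the number of columns whose cell is a class-`l`
cell. [this cell] -/
theorem hist_eq_cover (ε : Fin m → Fin m → Fin K → ℤ) (hstat : IsStatic ε)
    (q : Equiv.Perm (Fin m) × (Fin m → Fin K)) (hq : termSign ε q ≠ 0) (l : Fin K) :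
    (univ.filter fun b : Fin m => q.2 b = l) =
      univ.filter fun b : Fin m => (q.1 b, b) ∈ (univ.filter fun ab : Fin m × Fin m => ε ab.1 ab.2 l ≠ 0) := by
  ext b
  simp only [Finset.mem_filter, Finset.mem_univ, true_and]
  have hpres : ε (q.1 b) b (q.2 b) ≠ 0 := present_of_termSign_ne_zero ε q hq b
  exact ⟨fun h => by rw [h] at hpres; exact hpres, fun h => hstat _ _ _ _ hpres h⟩

/-- the class cell sets of a static design have total size at most `m²`. [folklore] -/
theorem sum_card_classCells_le (ε : Fin m → Fin m → Fin K → ℤ) (hstat : IsStatic ε) (s : Finset (Fin K)) :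
    ∑ l ∈ s, (((univ.filter fun ab : Fin m × Fin m => ε ab.1 ab.2 l ≠ 0).card : ℕ) : ℤ) ≤ (m : ℤ) ^ 2 := by
  have hdisj : (s : Set (Fin K)).PairwiseDisjoint fun l => univ.filter fun ab : Fin m × Fin m => ε ab.1 ab.2 l ≠ 0 := by
    intro l _ l' _ hll'
    rw [Function.onFun, Finset.disjoint_left]
    intro ab h1 h2
    rw [Finset.mem_filter] at h1 h2
    exact hll' (hstat ab.1 ab.2 l l' h1.2 h2.2)
  have h := Finset.card_biUnion hdisj
  have hle : (s.biUnion fun l => univ.filter fun ab : Fin m × Fin m => ε ab.1 ab.2 l ≠ 0).card ≤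
      (univ : Finset (Fin m × Fin m)).card := Finset.card_le_card (Finset.subset_univ _)
  rw [h, card_univ, Fintype.card_prod, Fintype.card_fin] at hle
  have : ((∑ l ∈ s, (univ.filter fun ab : Fin m × Fin m => ε ab.1 ab.2 l ≠ 0).card : ℕ) : ℤ) ≤ ((m * m : ℕ) : ℤ) := by
    exact_mod_cast hle
  push_cast at this
  linarith [this]

/-! ## 3. The law -/

/-- **THE BALANCED-SKELETON LAW FOR TERM FAMILIES** (integer form): a static design, a balanced skeleton `F` with parameters
`(r, λ)`, and ANY finite family `q : ι → terms` of present terms with pairwise distinct slopes and permutations in `F`: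
for every `t`, `t²·(|ι| − (2t+1)^(K−1)) ≤ m²·r + m³·(m·λ − r)` (truncated subtraction). [this cell] -/
theorem balancedTerms_law_int {ι : Type*} [Fintype ι] (F : Finset (Equiv.Perm (Fin m))) (r lam : ℕ)
    (hr : ∀ a b : Fin m, (F.filter fun π => π b = a).card = r)
    (hlam : ∀ a b a' b' : Fin m, a ≠ a' → b ≠ b' → (F.filter fun π => π b = a ∧ π b' = a').card ≤ lam)
    (d : Fin K → ℕ) (ε : Fin m → Fin m → Fin K → ℤ) (hstat : IsStatic ε)
    (q : ι → Equiv.Perm (Fin m) × (Fin m → Fin K)) (hpres : ∀ i, termSign ε (q i) ≠ 0)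
    (hslope : Function.Injective fun i => TropicalCensus.slope d (q i)) (hF : ∀ i, (q i).1 ∈ F) (t : ℕ) :
    (t : ℤ) ^ 2 * ((Fintype.card ι : ℤ) - (2 * t + 1) ^ (K - 1)) ≤ (m : ℤ) ^ 2 * r + (m : ℤ) ^ 3 * ((m * lam - r : ℕ) : ℤ) := by
  classical
  -- trivial sizes
  rcases Nat.eq_zero_or_pos m with hm | hm
  · -- `m = 0`: all terms are equal, so `|ι| ≤ 1`
    subst hm
    have hι : Fintype.card ι ≤ 1 := by
      rw [Fintype.card_le_one_iff]
      intro i j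
      exact hslope (by simp only; rw [show q i = q j from Prod.ext (Subsingleton.elim _ _) (funext fun b => b.elim0)])
    have h1 : (1 : ℤ) ≤ (2 * t + 1) ^ (K - 1) := one_le_pow₀ (by omega)
    have hι' : (Fintype.card ι : ℤ) ≤ 1 := by exact_mod_cast hι
    push_cast
    nlinarith [sq_nonneg (t : ℤ)]
  rcases Nat.eq_zero_or_pos K with hK | hK
  · subst hK
    have hι : Fintype.card ι = 0 := by
      rw [Fintype.card_eq_zero_iff]
      exact ⟨fun i => ((q i).2 ⟨0, hm⟩).elim0⟩
    rw [hι]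
    push_cast
    have h1 : (1 : ℤ) ≤ (2 * t + 1) ^ (0 - 1) := one_le_pow₀ (by omega)
    have h0 : (0 : ℤ) ≤ (m : ℤ) ^ 2 * r + (m : ℤ) ^ 3 * ((m * lam - r : ℕ) : ℤ) := by positivity
    nlinarith [sq_nonneg (t : ℤ), mul_nonneg (sq_nonneg (t : ℤ)) (sub_nonneg.mpr h1)]
  obtain ⟨K', rfl⟩ : ∃ K', K = K' + 1 := ⟨K - 1, by omega⟩
  simp only [Nat.add_sub_cancel]
  -- class cell sets and histograms
  set S : Fin K' → Finset (Fin m × Fin m) := fun l =>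
    univ.filter fun ab : Fin m × Fin m => ε ab.1 ab.2 (Fin.castSucc l) ≠ 0 with hS
  set H : ι → Fin (K' + 1) → ℤ := fun k l => ((univ.filter fun b : Fin m => (q k).2 b = l).card : ℤ) with hH
  -- (1) distinct slopes ⇒ full histograms injective
  have hHinj : Function.Injective H := by
    intro j k hjk
    apply hslope
    simp only
    rw [AffineSkeleton.slope_eq_sum_hist, AffineSkeleton.slope_eq_sum_hist]
    exact Finset.sum_congr rfl fun l _ => by have := congrFun hjk l; simp only [hH] at this; rw [this]
  -- (2) truncated histograms injective
  have htrunc : Function.Injective fun k => fun l : Fin K' => H k (Fin.castSucc l) := by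
    intro j k hjk
    apply hHinj
    funext l
    rcases Fin.eq_castSucc_or_eq_last l with ⟨l', rfl⟩ | rfl
    · exact congrFun hjk l'
    · have hj := AffineSkeleton.sum_hist (q j)
      have hk := AffineSkeleton.sum_hist (q k)
      rw [Fin.sum_univ_castSucc] at hj hk
      have e : ∑ l : Fin K', H j (Fin.castSucc l) = ∑ l : Fin K', H k (Fin.castSucc l) :=
        Finset.sum_congr rfl fun l _ => congrFun hjk l
      simp only [hH] at e ⊢
      linarith
  -- (3) histograms are coverage counts
  have hcov : ∀ k (l : Fin K'), H k (Fin.castSucc l) =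
      ((univ.filter fun b : Fin m => ((q k).1 b, b) ∈ S l).card : ℤ) := fun k l => by
    simp only [hH, hS]; rw [hist_eq_cover ε hstat (q k) (hpres k) (Fin.castSucc l)]
  -- (4) the family of chain permutations, injectivity of the coverage vector on it
  set A : Finset (Equiv.Perm (Fin m)) := univ.image fun k => (q k).1 with hA
  have hG : Set.InjOn (fun π : Equiv.Perm (Fin m) => fun l : Fin K' =>
      ((univ.filter fun b : Fin m => (π b, b) ∈ S l).card : ℤ)) A := by
    intro π hπ π' hπ' e
    rw [hA, Finset.coe_image] at hπ hπ'
    obtain ⟨j, -, rfl⟩ := hπ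
    obtain ⟨k, -, rfl⟩ := hπ'
    rw [show j = k from htrunc (funext fun l => by simp only; rw [hcov j l, hcov k l]; exact congrFun e l)]
  have hfinj : Function.Injective fun k => (q k).1 := fun j k e => by
    apply htrunc; funext l; simp only at e ⊢; rw [hcov j l, hcov k l, e]
  have hAcard : A.card = Fintype.card ι := by rw [hA, Finset.card_image_of_injective _ hfinj, card_univ]
  have hAF : A ⊆ F := fun π hπ => by
    rw [hA, Finset.mem_image] at hπ
    obtain ⟨k, -, rfl⟩ := hπ
    exact hF k
  -- (5) packing at scale `m`, centre `(|S l|)_l`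
  have hm' : (0 : ℤ) < m := by exact_mod_cast hm
  have hpack := AffinePlane.packing A K'
    (fun π : Equiv.Perm (Fin m) => fun l : Fin K' => ((univ.filter fun b : Fin m => (π b, b) ∈ S l).card : ℤ)) hG
    (fun l => ((S l).card : ℤ)) hm' t
  rw [hAcard] at hpack
  -- (6) variance budget summed over classes
  have hvar : ∑ π ∈ A, ∑ l, ((m : ℤ) * ((univ.filter fun b : Fin m => (π b, b) ∈ S l).card : ℤ) - (S l).card) ^ 2
      ≤ ∑ l : Fin K', (m : ℤ) * (S l).card * (m * r + (S l).card * (m * lam - r)) :=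
    (Finset.sum_le_sum_of_subset_of_nonneg hAF (fun π _ _ => Finset.sum_nonneg fun l _ => sq_nonneg _)).trans
      (le_of_eq_of_le Finset.sum_comm (Finset.sum_le_sum fun l _ => cover_variance_le F r lam hr hlam (S l)))
  -- (7) crude bound of the class budget: `|S l|·(mλ − r) ≤ m²·(mλ ∸ r)` and `Σ_l |S l| ≤ m²`
  have hsumS : ∑ l : Fin K', ((S l).card : ℤ) ≤ (m : ℤ) ^ 2 := by
    have himg := sum_card_classCells_le ε hstat ((univ : Finset (Fin K')).image Fin.castSucc)
    rw [Finset.sum_image (fun a _ b _ h => Fin.castSucc_injective _ h)] at himg; simpa only [hS] using himg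
  have hE : ((m : ℤ) * lam - r) ≤ ((m * lam - r : ℕ) : ℤ) := by omega
  have hterm : ∀ l : Fin K', (m : ℤ) * (S l).card * (m * r + (S l).card * (m * lam - r)) ≤
      (S l).card * ((m : ℤ) ^ 2 * r + (m : ℤ) ^ 3 * ((m * lam - r : ℕ) : ℤ)) := by
    intro l
    have hSl : ((S l).card : ℤ) ≤ (m : ℤ) ^ 2 := by
      have := Finset.card_le_card (Finset.subset_univ (S l))
      rw [card_univ, Fintype.card_prod, Fintype.card_fin, ← sq] at this
      exact_mod_cast this
    have hS0 : (0 : ℤ) ≤ (S l).card := by positivity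
    have h1 : ((S l).card : ℤ) * (m * lam - r) ≤ (m : ℤ) ^ 2 * ((m * lam - r : ℕ) : ℤ) :=
      (mul_le_mul_of_nonneg_left hE hS0).trans (mul_le_mul_of_nonneg_right hSl (by positivity))
    nlinarith [mul_le_mul_of_nonneg_left h1 (mul_nonneg (show (0 : ℤ) ≤ m by positivity) hS0)]
  have hbudget : ∑ l : Fin K', (m : ℤ) * (S l).card * (m * r + (S l).card * (m * lam - r)) ≤
      (m : ℤ) ^ 2 * ((m : ℤ) ^ 2 * r + (m : ℤ) ^ 3 * ((m * lam - r : ℕ) : ℤ)) := by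
    refine (Finset.sum_le_sum fun l _ => hterm l).trans ?_
    rw [← Finset.sum_mul]
    exact mul_le_mul_of_nonneg_right hsumS (by positivity)
  have key : (t : ℤ) ^ 2 * (m : ℤ) ^ 2 * ((Fintype.card ι : ℕ) - (2 * t + 1) ^ K' : ℤ) ≤
      (m : ℤ) ^ 2 * ((m : ℤ) ^ 2 * r + (m : ℤ) ^ 3 * ((m * lam - r : ℕ) : ℤ)) := hpack.trans (hvar.trans hbudget)
  have hm2 : (0 : ℤ) < (m : ℤ) ^ 2 := by positivity
  have : (m : ℤ) ^ 2 * ((t : ℤ) ^ 2 * ((Fintype.card ι : ℤ) - (2 * t + 1) ^ K')) ≤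
      (m : ℤ) ^ 2 * ((m : ℤ) ^ 2 * r + (m : ℤ) ^ 3 * ((m * lam - r : ℕ) : ℤ)) := by
    linarith [key]
  exact le_of_mul_le_mul_left this hm2

/-- **THE BALANCED-SKELETON LAW** (chains, integer form): for every `t`,
`t²·((n+1) − (2t+1)^(K−1)) ≤ m²·r + m³·(m·λ − r)` (the last subtraction truncated at `0`). [this cell] -/
theorem balancedSkeleton_law_int (F : Finset (Equiv.Perm (Fin m))) (r lam : ℕ)
    (hr : ∀ a b : Fin m, (F.filter fun π => π b = a).card = r)
    (hlam : ∀ a b a' b' : Fin m, a ≠ a' → b ≠ b' → (F.filter fun π => π b = a ∧ π b' = a').card ≤ lam)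
    (d : Fin K → ℕ) (v ε : Fin m → Fin m → Fin K → ℤ) (hstat : IsStatic ε)
    {n : ℕ} (θ : Fin (n + 1) → ℤ) (q : Fin (n + 1) → Equiv.Perm (Fin m) × (Fin m → Fin K))
    (hθ : StrictMono θ) (hdom : ∀ k, IsDominant d v ε (θ k) (q k))
    (hne : ∀ k : Fin n, q k.castSucc ≠ q k.succ) (hF : ∀ k, (q k).1 ∈ F) (t : ℕ) :
    (t : ℤ) ^ 2 * ((n + 1 : ℤ) - (2 * t + 1) ^ (K - 1)) ≤ (m : ℤ) ^ 2 * r + (m : ℤ) ^ 3 * ((m * lam - r : ℕ) : ℤ) := by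
  have hsm : StrictMono fun k => TropicalCensus.slope d (q k) := by
    rw [Fin.strictMono_iff_lt_succ]
    intro k
    exact slope_lt_of_dominant d v ε (hθ Fin.castSucc_lt_succ) (hne k) (hdom _) (hdom _)
  have h := balancedTerms_law_int F r lam hr hlam d ε hstat q (fun k => (hdom k).1) hsm.injective hF t
  rw [Fintype.card_fin] at h; push_cast at h; exact h

/-- **THE BALANCED-SKELETON LAW** (natural-number form): `t²·(n+1) ≤ m²·r + m³·(m·λ − r) + t²·(2t+1)^(K−1)` for every `t`
(truncated subtraction).  For 2-design-like skeletons (`mλ ≈ r`) this reads `n + 1 = O((m·|F|)^{(K−1)/(K+1)})`: at `K = 3` at most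
`≈ √(m·|F|)` states. [this cell] -/
theorem balancedSkeleton_law (F : Finset (Equiv.Perm (Fin m))) (r lam : ℕ)
    (hr : ∀ a b : Fin m, (F.filter fun π => π b = a).card = r)
    (hlam : ∀ a b a' b' : Fin m, a ≠ a' → b ≠ b' → (F.filter fun π => π b = a ∧ π b' = a').card ≤ lam)
    (d : Fin K → ℕ) (v ε : Fin m → Fin m → Fin K → ℤ) (hstat : IsStatic ε)
    {n : ℕ} (θ : Fin (n + 1) → ℤ) (q : Fin (n + 1) → Equiv.Perm (Fin m) × (Fin m → Fin K))
    (hθ : StrictMono θ) (hdom : ∀ k, IsDominant d v ε (θ k) (q k))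
    (hne : ∀ k : Fin n, q k.castSucc ≠ q k.succ) (hF : ∀ k, (q k).1 ∈ F) (t : ℕ) :
    t ^ 2 * (n + 1) ≤ m ^ 2 * r + m ^ 3 * (m * lam - r) + t ^ 2 * (2 * t + 1) ^ (K - 1) := by
  have h := balancedSkeleton_law_int F r lam hr hlam d v ε hstat θ q hθ hdom hne hF t
  have : ((t ^ 2 * (n + 1) : ℕ) : ℤ) ≤ ((m ^ 2 * r + m ^ 3 * (m * lam - r) + t ^ 2 * (2 * t + 1) ^ (K - 1) : ℕ) : ℤ) := by
    push_cast
    have e : (((m * lam - r : ℕ) : ℤ)) = ((m * lam - r : ℕ) : ℤ) := rfl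
    linarith
  exact_mod_cast this

/-- the same for SIGN-ALTERNATING chains (the crux's hypotheses). [this cell] -/
theorem balancedSkeleton_law_signed (F : Finset (Equiv.Perm (Fin m))) (r lam : ℕ)
    (hr : ∀ a b : Fin m, (F.filter fun π => π b = a).card = r)
    (hlam : ∀ a b a' b' : Fin m, a ≠ a' → b ≠ b' → (F.filter fun π => π b = a ∧ π b' = a').card ≤ lam)
    (d : Fin K → ℕ) (v ε : Fin m → Fin m → Fin K → ℤ) (hstat : IsStatic ε)
    {n : ℕ} (θ : Fin (n + 1) → ℤ) (q : Fin (n + 1) → Equiv.Perm (Fin m) × (Fin m → Fin K))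
    (hθ : StrictMono θ) (hdom : ∀ k, IsDominant d v ε (θ k) (q k))
    (halt : ∀ k : Fin n, termSign ε (q k.castSucc) * termSign ε (q k.succ) < 0) (hF : ∀ k, (q k).1 ∈ F) (t : ℕ) :
    t ^ 2 * (n + 1) ≤ m ^ 2 * r + m ^ 3 * (m * lam - r) + t ^ 2 * (2 * t + 1) ^ (K - 1) := by
  refine balancedSkeleton_law F r lam hr hlam d v ε hstat θ q hθ hdom (fun k h => ?_) hF t
  have := halt k
  rw [h] at this
  exact absurd this (not_lt.mpr (mul_self_nonneg _))

/-- **`K = 3` (two-register format), closed form**: `(n + 1)² ≤ 128·(m²·r + m³·(m·λ − r)) + 4096`; for 2-design-like skeletons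
(`mλ − r ≤ r/(m−1)`) this is `n + 1 = O(√(m·|F|))`. [this cell] -/
theorem balancedSkeleton_three (F : Finset (Equiv.Perm (Fin m))) (r lam : ℕ)
    (hr : ∀ a b : Fin m, (F.filter fun π => π b = a).card = r)
    (hlam : ∀ a b a' b' : Fin m, a ≠ a' → b ≠ b' → (F.filter fun π => π b = a ∧ π b' = a').card ≤ lam)
    (d : Fin 3 → ℕ) (v ε : Fin m → Fin m → Fin 3 → ℤ) (hstat : IsStatic ε)
    {n : ℕ} (θ : Fin (n + 1) → ℤ) (q : Fin (n + 1) → Equiv.Perm (Fin m) × (Fin m → Fin 3))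
    (hθ : StrictMono θ) (hdom : ∀ k, IsDominant d v ε (θ k) (q k))
    (hne : ∀ k : Fin n, q k.castSucc ≠ q k.succ) (hF : ∀ k, (q k).1 ∈ F) :
    (n + 1) ^ 2 ≤ 128 * (m ^ 2 * r + m ^ 3 * (m * lam - r)) + 4096 := by
  have h := fun t => balancedSkeleton_law_int F r lam hr hlam d v ε hstat θ q hθ hdom hne hF t
  have h' : ∀ t : ℕ, (t : ℤ) ^ 2 * (((n + 1 : ℕ) : ℤ) - (2 * t + 1) ^ 2) ≤
      (m : ℤ) ^ 2 * r + (m : ℤ) ^ 3 * ((m * lam - r : ℕ) : ℤ) := by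
    intro t
    have := h t
    push_cast at this ⊢
    exact this
  have := AffinePlane.sq_le_of_law_two (n + 1) _ h'
  have e : (((n + 1) ^ 2 : ℕ) : ℤ) ≤ ((128 * (m ^ 2 * r + m ^ 3 * (m * lam - r)) + 4096 : ℕ) : ℤ) := by
    push_cast at this ⊢
    have ee : (((m * lam - r : ℕ) : ℤ)) = ((m * lam - r : ℕ) : ℤ) := rfl
    linarith
  exact_mod_cast e

end BalancedSkeleton

end Summit.ValiantsHypothesis.ValiantsHypothesis.Theorems.KPlusLogSqLaw
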